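import Summits.Ventures.Crystal3D.Theorems.StickyWulffConstantGenericWallFloorBarlowRowFamiliesApart
import HarnessLib

/-!
# The «−−» c-layer ROW family of plate 1: stack walkers of the BASAL TWIN grain `⟨twinFrame L₁ (L₁ e₃), r, 0⟩`, frames apart from the top plate
# (crux `GenericWallFloor`, stmt-Ventures-19480, kernel G; LAYER ROWS R1 step (iii-b), cf-p1 (ccxi)/(ccxiii); mirror of `rowBottomFamily_spec_apart`)

HONEST FRAMING. Venture `Summits/Ventures/Crystal3D` (cell `crystal3d-full`), route `route-Ventures-StickyWulffConstant`, helper for the crux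
`GenericWallFloor` (stmt-Ventures-19480) / consumer `TextureLiminfV5` (stmt-Ventures-23912).  Bookkeeping on landed pieces; input BY NAME: E1
(`hsE`, `hcert`); F-C1 not moved; NOT R1.

THE POINT.  `rowBottomFamily_spec_apart` (`…BarlowRowFamiliesApart`) launches one stack walker `⟨L₁, r, 0⟩` per «++» c-layer row of plate 1
crossing the band — the only layers whose sites are `L₁`-FULL.  A site of a «−−» c-layer `k` (`σ₁ k = σ₁ (k−1) = −1`) carries instead the basal-mirrored
cuboctahedron: it is FULL for the twin frame `G₁ = twinFrame L₁ (L₁ e₃)` (`G₁ x = L₁ (basalMirror x)`; `barlow_twin_full`), and the in-plane row slot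
is moved identically (`G₁ r = L₁ r`, steep).  So the «−−» rows are walked by the second grain `⟨G₁, r, 0⟩`, and this file is the verbatim mirror of the
«++» family spec: per member validity (`rowStart_valid` in the frame `G₁`), strong certificate, fuel, END in `PAY` (not high by core avoidance —
`walkEnd_mem_PAY_apart` with the frame set `chainFrames e₃ G₁ r`, apart from `L₂·Λ₀` and its basal twin —, not low by the sealing of plate 1), and
injectivity of `walkRun` on the family (`rowFamily_walkRun_injOn` in the frame `G₁`, model points `basalMirror p`).
* `barlow_twin_full`, `twinFrame_basal_comp_mirror`; **`rowTwinFamily_spec_apart`**.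
WHAT THIS IS NOT: not the count, not R1; F-C1 not moved.
-/

noncomputable section

namespace Summit.Ventures.Crystal3D.Theorems

open Finset
open Literature.MathematicalPhysics.StatisticalMechanics
open Summit.Ventures.Crystal3D.Cruxes.TextureLiminf.TexShadow (stacking)
open scoped InnerProductSpace

variable {X : Finset (EuclideanSpace ℝ (Fin 3))}

/-! ### «−−» sites are full for the twin frame -/

/-- `G₁ (basalMirror x) = L₁ x` for the basal twin frame `G₁ = twinFrame L₁ (L₁ e₃)`. -/
theorem twinFrame_basal_comp_mirror (L : EuclideanSpace ℝ (Fin 3) ≃ₗᵢ[ℝ] EuclideanSpace ℝ (Fin 3)) (x : EuclideanSpace ℝ (Fin 3)) :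
    twinFrame L (L (EuclideanSpace.single (2 : Fin 3) (1 : ℝ))) (basalMirror x) = L x := by
  rw [twinFrame_axis_apply, basalMirror_basalMirror]

/-- **A «−−» c-layer site with its stacking neighbours occupied is FULL for the twin frame**: `σ k = σ (k−1) = −1` ⇒ the site and its twelve
points `L p + s₀ + L (basalMirror w)` (`w` a slot) are balls. -/
theorem barlow_twin_full (σ : ℤ → ℤ) (L : EuclideanSpace ℝ (Fin 3) ≃ₗᵢ[ℝ] EuclideanSpace ℝ (Fin 3)) (s₀ : EuclideanSpace ℝ (Fin 3))
    (k i j : ℤ) (hk : σ k = -1) (hk' : σ (k - 1) = -1)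
    (hX : ∀ q ∈ barlowStacking 1 (Real.sqrt (2 / 3)) σ, dist q (barlowPos 1 (Real.sqrt (2 / 3)) σ k i j) ≤ 1 → L q + s₀ ∈ X) :
    L (barlowPos 1 (Real.sqrt (2 / 3)) σ k i j) + s₀ ∈ X ∧
      ∀ w ∈ fccSlots, L (barlowPos 1 (Real.sqrt (2 / 3)) σ k i j) + s₀ +
        twinFrame L (L (EuclideanSpace.single (2 : Fin 3) (1 : ℝ))) w ∈ X := by
  refine ⟨?_, fun w hw => ?_⟩
  · have := hX _ (barlowPos_mem k i j) (by rw [dist_self]; norm_num)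
    exact this
  rw [twinFrame_axis_apply]
  have hn : ‖basalMirror w‖ ≤ 1 := by rw [LinearIsometryEquiv.norm_map, norm_eq_one_of_mem_fccSlots hw]
  rcases slot_apply_two_cases hw with h | h | h
  · rcases Set.mem_union _ _ _ |>.1 (barlow_nabla_add_slot_mem σ k i j hk hw h.le) with h' | h'
    · exact mem_of_site_near hX hn h'
    · exact mem_of_site_near hX hn h'
  · exact mem_of_site_near hX hn (barlow_nabla_sub_slot_mem σ k i j hk' hw h)
  · rcases Set.mem_union _ _ _ |>.1 (barlow_nabla_add_slot_mem σ k i j hk hw (by rw [h]; exact neg_nonpos.2 (Real.sqrt_nonneg _))) with h' | h'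
    · exact mem_of_site_near hX hn h'
    · exact mem_of_site_near hX hn h'

/-! ### The «−−» row family -/

section Cell

variable (σ₁ : ℤ → ℤ) (L₁ : EuclideanSpace ℝ (Fin 3) ≃ₗᵢ[ℝ] EuclideanSpace ℝ (Fin 3)) (s₀ : EuclideanSpace ℝ (Fin 3))

open scoped Classical in
/-- **The «−−» ROW family of plate 1 (twin grain), frames apart from the top plate, delivers every input of the count.**  Verbatim
`rowBottomFamily_spec_apart` with: layers `σ₁ (mi i) = σ₁ (mi i − 1) = −1`, walkers `⟨G₁, r, 0⟩` with `G₁ = twinFrame L₁ (L₁ e₃)`, `r` an IN-PLANE row slot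
(`r = α·t₁ + β·t₂`, `L₁ r` steep), `hapart` on `chainFrames e₃ G₁ r`. -/
theorem rowTwinFamily_spec_apart (hσ₁ : IsHaggSeq σ₁) (hX : ∀ p ∈ X, ∀ q ∈ X, p ≠ q → 1 ≤ dist p q)
    {sE : EuclideanSpace ℝ (Fin 3)} (hsE : sE ∈ fccSlots) (hcert : ExactOnly 0 (fccSlots.filter fun w => 0 < ⟪w, sE⟫_ℝ))
    -- the cell
    {σ₂ : ℤ → ℤ} (hσ₂ : IsHaggSeq σ₂) (L₂ : EuclideanSpace ℝ (Fin 3) ≃ₗᵢ[ℝ] EuclideanSpace ℝ (Fin 3)) (s₂ : EuclideanSpace ℝ (Fin 3))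
    (R₀ h ρ : ℝ) (hR₀ : 6 ≤ R₀) (hh : 0 ≤ h) (hρ : 1 ≤ ρ) (P₁ P₂ : Finset (EuclideanSpace ℝ (Fin 3))) (hP₁X : P₁ ⊆ X) (hP₂X : P₂ ⊆ X)
    (hcell : ∀ p ∈ X, -(2 * R₀) ≤ p 2 ∧ p 2 ≤ h + 2 * R₀ ∧ p 0 ^ 2 + p 1 ^ 2 ≤ ρ ^ 2)
    (hP₁ : ∀ p, p ∈ P₁ ↔ (p ∈ stacking L₁ s₀ σ₁ ∧ -(2 * R₀) ≤ p 2 ∧ p 2 ≤ -R₀ ∧ p 0 ^ 2 + p 1 ^ 2 ≤ ρ ^ 2))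
    (hP₂ : ∀ p, p ∈ P₂ ↔ (p ∈ stacking L₂ s₂ σ₂ ∧ h + R₀ ≤ p 2 ∧ p 2 ≤ h + 2 * R₀ ∧ p 0 ^ 2 + p 1 ^ 2 ≤ ρ ^ 2))
    -- the row data
    {r : EuclideanSpace ℝ (Fin 3)} (hr : r ∈ fccSlots) (α β : ℤ)
    (hrαβ : r = (α : ℝ) • triangularVec₁ 1 + (β : ℝ) • triangularVec₂ 1)
    (hsteep : Real.sqrt 2 / 2 ≤ ⟪L₁ r, EuclideanSpace.single (2 : Fin 3) (1 : ℝ)⟫_ℝ)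
    -- frames apart from the top plate
    (hapart : ∀ F ∈ chainFrames (EuclideanSpace.single (2 : Fin 3) (1 : ℝ))
        (twinFrame L₁ (L₁ (EuclideanSpace.single (2 : Fin 3) (1 : ℝ)))) r,
      F '' fccStacking 1 (Real.sqrt (2 / 3)) ≠ L₂ '' fccStacking 1 (Real.sqrt (2 / 3)) ∧
      F '' fccStacking 1 (Real.sqrt (2 / 3)) ≠
        (twinFrame L₂ (L₂ (EuclideanSpace.single (2 : Fin 3) (1 : ℝ)))) '' fccStacking 1 (Real.sqrt (2 / 3)))
    -- the family
    (H ρin : ℝ) (hHlo : -(2 * R₀) + 2 ≤ H) (hHhi : H ≤ -R₀ - 3)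
    (hρin : ρin + 8 / 3 * (h + 4 * R₀) + 2 ≤ ρ - 1)
    {ι : Type*} (T : Finset ι) (mi ai bi : ι → ℤ)
    (hmm : ∀ i ∈ T, σ₁ (mi i) = -1 ∧ σ₁ (mi i - 1) = -1)
    (hlow : ∀ i ∈ T, H ≤ ⟪L₁ (barlowPos 1 (Real.sqrt (2 / 3)) σ₁ (mi i) (ai i) (bi i)) + s₀, EuclideanSpace.single (2 : Fin 3) (1 : ℝ)⟫_ℝ)
    (hpred : ∀ i ∈ T, ⟪L₁ (barlowPos 1 (Real.sqrt (2 / 3)) σ₁ (mi i) (ai i - α) (bi i - β)) + s₀,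
      EuclideanSpace.single (2 : Fin 3) (1 : ℝ)⟫_ℝ < H)
    (hinjT : ∀ i ∈ T, ∀ j ∈ T,
      barlowPos 1 (Real.sqrt (2 / 3)) σ₁ (mi i) (ai i) (bi i) = barlowPos 1 (Real.sqrt (2 / 3)) σ₁ (mi j) (ai j) (bi j) → i = j)
    (hlat : ∀ i ∈ T, Real.sqrt ((L₁ (barlowPos 1 (Real.sqrt (2 / 3)) σ₁ (mi i) (ai i) (bi i)) + s₀) 0 ^ 2 +
      (L₁ (barlowPos 1 (Real.sqrt (2 / 3)) σ₁ (mi i) (ai i) (bi i)) + s₀) 1 ^ 2) ≤ ρin)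
    -- fuel
    {N : ℕ} (hN2 : 8 * (h + 4 * R₀) < 3 * (N : ℝ)) :
    (∀ i ∈ T,
      WalkInv X (EuclideanSpace.single (2 : Fin 3) (1 : ℝ))
          (L₁ (barlowPos 1 (Real.sqrt (2 / 3)) σ₁ (mi i) (ai i) (bi i)) + s₀,
            [⟨twinFrame L₁ (L₁ (EuclideanSpace.single (2 : Fin 3) (1 : ℝ))), r, 0⟩]) ∧
      StackWF (EuclideanSpace.single (2 : Fin 3) (1 : ℝ))
        ([⟨twinFrame L₁ (L₁ (EuclideanSpace.single (2 : Fin 3) (1 : ℝ))), r, 0⟩] : List WalkEntry) ∧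
      ([⟨twinFrame L₁ (L₁ (EuclideanSpace.single (2 : Fin 3) (1 : ℝ))), r, 0⟩] : List WalkEntry).getLast? =
        some ⟨twinFrame L₁ (L₁ (EuclideanSpace.single (2 : Fin 3) (1 : ℝ))), r, 0⟩ ∧
      (∃ e rest, ([⟨twinFrame L₁ (L₁ (EuclideanSpace.single (2 : Fin 3) (1 : ℝ))), r, 0⟩] : List WalkEntry) = e :: rest ∧
        WalkCertified12 X (L₁ (barlowPos 1 (Real.sqrt (2 / 3)) σ₁ (mi i) (ai i) (bi i)) + s₀) e) ∧
      8 * (h + 2 * R₀ - ⟪L₁ (barlowPos 1 (Real.sqrt (2 / 3)) σ₁ (mi i) (ai i) (bi i)) + s₀,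
        EuclideanSpace.single (2 : Fin 3) (1 : ℝ)⟫_ℝ) < 3 * N ∧
      (walkRun X (EuclideanSpace.single (2 : Fin 3) (1 : ℝ)) N
          (L₁ (barlowPos 1 (Real.sqrt (2 / 3)) σ₁ (mi i) (ai i) (bi i)) + s₀,
            [⟨twinFrame L₁ (L₁ (EuclideanSpace.single (2 : Fin 3) (1 : ℝ))), r, 0⟩])).1 ∈
        X.filter (fun y => (X.filter fun q => dist y q = 1).card ≠ 12 ∧ -R₀ - 2 ≤ y 2 ∧ y 2 ≤ h + R₀ + 2)) ∧
    (∀ i ∈ T, ∀ j ∈ T,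
      walkRun X (EuclideanSpace.single (2 : Fin 3) (1 : ℝ)) N
          (L₁ (barlowPos 1 (Real.sqrt (2 / 3)) σ₁ (mi i) (ai i) (bi i)) + s₀,
            [⟨twinFrame L₁ (L₁ (EuclideanSpace.single (2 : Fin 3) (1 : ℝ))), r, 0⟩]) =
        walkRun X (EuclideanSpace.single (2 : Fin 3) (1 : ℝ)) N
          (L₁ (barlowPos 1 (Real.sqrt (2 / 3)) σ₁ (mi j) (ai j) (bi j)) + s₀,
            [⟨twinFrame L₁ (L₁ (EuclideanSpace.single (2 : Fin 3) (1 : ℝ))), r, 0⟩]) → i = j) := by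
  set e₃ : EuclideanSpace ℝ (Fin 3) := EuclideanSpace.single (2 : Fin 3) (1 : ℝ) with he₃
  have he₃n : ‖e₃‖ = 1 := by rw [he₃, PiLp.norm_single, norm_one]
  have he₃i : ∀ d : EuclideanSpace ℝ (Fin 3), ⟪d, e₃⟫_ℝ = d 2 := fun d => by
    rw [he₃, EuclideanSpace.inner_single_right]; simp
  set G₁ : EuclideanSpace ℝ (Fin 3) ≃ₗᵢ[ℝ] EuclideanSpace ℝ (Fin 3) := twinFrame L₁ (L₁ e₃) with hG₁
  set bp : ℤ → ℤ → ℤ → EuclideanSpace ℝ (Fin 3) := fun m a b => barlowPos 1 (Real.sqrt (2 / 3)) σ₁ m a b with hbp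
  have hGm : ∀ x, G₁ (basalMirror x) = L₁ x := twinFrame_basal_comp_mirror L₁
  have hr2 : r 2 = 0 := by
    rw [hrαβ]; simp [triangularVec₁, triangularVec₂]
  have hMr : basalMirror r = r := basalMirror_of_inPlane hr2
  have hGr : G₁ r = L₁ r := by rw [← hMr, hGm, hMr]
  have hsteepG : Real.sqrt 2 / 2 ≤ ⟪G₁ r, e₃⟫_ℝ := by rw [hGr]; exact hsteep
  have hLr : ‖L₁ r‖ = 1 := by rw [LinearIsometryEquiv.norm_map, norm_eq_one_of_mem_fccSlots hr]
  have hLr2 : (L₁ r) 2 ≤ 1 := by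
    have h1 := abs_apply_sub_le_dist (L₁ r) 0 2
    rw [dist_zero_right, hLr] at h1
    have : (0 : EuclideanSpace ℝ (Fin 3)) 2 = 0 := rfl
    rw [this, sub_zero] at h1
    exact (abs_le.1 h1).2
  -- the predecessor of each start: `q i + r = p i`
  have hqp : ∀ i, bp (mi i) (ai i - α) (bi i - β) + r = bp (mi i) (ai i) (bi i) := by
    intro i
    show barlowPos 1 (Real.sqrt (2 / 3)) σ₁ (mi i) (ai i - α) (bi i - β) + r = barlowPos 1 (Real.sqrt (2 / 3)) σ₁ (mi i) (ai i) (bi i)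
    rw [hrαβ, barlowPos_add_inplane, sub_add_cancel, sub_add_cancel]
  have hqeq : ∀ i, bp (mi i) (ai i) (bi i) - r = bp (mi i) (ai i - α) (bi i - β) := fun i => by
    rw [← hqp i, add_sub_cancel_right]
  -- model points in the twin frame's coordinates
  have hGp : ∀ i, G₁ (basalMirror (bp (mi i) (ai i) (bi i))) + s₀ = L₁ (bp (mi i) (ai i) (bi i)) + s₀ := fun i => by rw [hGm]
  have hGq : ∀ i, G₁ (basalMirror (bp (mi i) (ai i) (bi i)) - r) + s₀ = L₁ (bp (mi i) (ai i - α) (bi i - β)) + s₀ := fun i => by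
    rw [← hqeq i, ← hGm, map_sub basalMirror, hMr]
  -- heights and lateral radius of the predecessor
  have hq2 : ∀ i, (L₁ (bp (mi i) (ai i - α) (bi i - β)) + s₀) 2 = (L₁ (bp (mi i) (ai i) (bi i)) + s₀) 2 - (L₁ r) 2 := by
    intro i; rw [← hqp i, map_add]; simp; ring
  -- the predecessor is deep, hence full for the twin frame
  have hfullpred : ∀ i ∈ T, L₁ (bp (mi i) (ai i - α) (bi i - β)) + s₀ ∈ X ∧
      ∀ w ∈ fccSlots, L₁ (bp (mi i) (ai i - α) (bi i - β)) + s₀ + G₁ w ∈ X := by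
    intro i hi
    have hph : (L₁ (bp (mi i) (ai i - α) (bi i - β)) + s₀) 2 < H := by rw [← he₃i]; exact hpred i hi
    have hpl : H - 1 ≤ (L₁ (bp (mi i) (ai i - α) (bi i - β)) + s₀) 2 := by
      rw [hq2 i]; have := hlow i hi; rw [he₃i] at this; linarith
    have hplat : Real.sqrt ((L₁ (bp (mi i) (ai i - α) (bi i - β)) + s₀) 0 ^ 2 +
        (L₁ (bp (mi i) (ai i - α) (bi i - β)) + s₀) 1 ^ 2) ≤ ρin + 1 := by
      have h1 := sqrt_lateral_add_le (L₁ (bp (mi i) (ai i) (bi i)) + s₀) (-(L₁ r))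
      have e : L₁ (bp (mi i) (ai i) (bi i)) + s₀ + -L₁ r = L₁ (bp (mi i) (ai i - α) (bi i - β)) + s₀ := by
        rw [← hqp i, map_add]; abel
      rw [e, norm_neg, hLr] at h1
      have := hlat i hi; linarith
    refine barlow_twin_full σ₁ L₁ s₀ (mi i) (ai i - α) (bi i - β) (hmm i hi).1 (hmm i hi).2
      (barlowWindow_complete L₁ s₀ R₀ ρ hρ P₁ hP₁X hP₁ (mi i) (ai i - α) (bi i - β) (by linarith) (by linarith) ?_)
    have h0 : 0 ≤ (L₁ (bp (mi i) (ai i - α) (bi i - β)) + s₀) 0 ^ 2 + (L₁ (bp (mi i) (ai i - α) (bi i - β)) + s₀) 1 ^ 2 := by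
      positivity
    have hrr : Real.sqrt ((L₁ (bp (mi i) (ai i - α) (bi i - β)) + s₀) 0 ^ 2 +
        (L₁ (bp (mi i) (ai i - α) (bi i - β)) + s₀) 1 ^ 2) ≤ ρ - 1 := by
      have : 0 ≤ 8 / 3 * (h + 4 * R₀) := by positivity
      linarith
    have h7 := pow_le_pow_left₀ (Real.sqrt_nonneg _) hrr 2
    rwa [Real.sq_sqrt h0] at h7
  -- the same fullness in the twin frame's coordinates
  have hfullpred' : ∀ i ∈ T, G₁ (basalMirror (bp (mi i) (ai i) (bi i)) - r) + s₀ ∈ X ∧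
      ∀ w ∈ fccSlots, G₁ (basalMirror (bp (mi i) (ai i) (bi i)) - r) + s₀ + G₁ w ∈ X := by
    intro i hi; rw [hGq i]; exact hfullpred i hi
  -- validity of every start
  have hvalid : ∀ i ∈ T, WalkInv X e₃ (L₁ (bp (mi i) (ai i) (bi i)) + s₀, [⟨G₁, r, 0⟩]) ∧
      StackWF e₃ ([⟨G₁, r, 0⟩] : List WalkEntry) ∧ ([⟨G₁, r, 0⟩] : List WalkEntry).getLast? = some ⟨G₁, r, 0⟩ ∧
      WalkCertified12 X (L₁ (bp (mi i) (ai i) (bi i)) + s₀) ⟨G₁, r, 0⟩ := by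
    intro i hi
    have h := rowStart_valid G₁ s₀ hr hsteepG (sub_add_cancel (basalMirror (bp (mi i) (ai i) (bi i))) r)
      (hfullpred' i hi).1 (hfullpred' i hi).2
    rw [hGp i] at h
    exact h
  -- injectivity
  have hinj' := rowFamily_walkRun_injOn hX hsE hcert he₃n G₁ s₀ hr hsteepG T (fun i => basalMirror (bp (mi i) (ai i) (bi i)))
    hfullpred' H (fun i hi => by simp only [hGp i]; exact hlow i hi)
    (fun i hi => by simp only [hGq i]; exact hpred i hi)
    (fun i hi j hj hij => hinjT i hi j hj (basalMirror.injective hij)) N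
  have hinj : ∀ i ∈ T, ∀ j ∈ T,
      walkRun X e₃ N (L₁ (bp (mi i) (ai i) (bi i)) + s₀, [⟨G₁, r, 0⟩]) =
        walkRun X e₃ N (L₁ (bp (mi j) (ai j) (bi j)) + s₀, [⟨G₁, r, 0⟩]) → i = j := by
    intro i hi j hj hij
    refine hinj' i hi j hj ?_
    simp only [hGp]; exact hij
  refine ⟨fun i hi => ?_, hinj⟩
  obtain ⟨hI, hW, hlast, hC⟩ := hvalid i hi
  have hstartX : L₁ (bp (mi i) (ai i) (bi i)) + s₀ ∈ X := hI.1
  have hstart2 : H ≤ (L₁ (bp (mi i) (ai i) (bi i)) + s₀) 2 := by rw [← he₃i]; exact hlow i hi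
  have hfuel : 8 * (h + 2 * R₀ - ⟪L₁ (bp (mi i) (ai i) (bi i)) + s₀, e₃⟫_ℝ) < 3 * N := by
    rw [he₃i]; linarith
  -- frames of the family, lateral margin
  have hM₁ : ∀ stk : List WalkEntry, StackSound e₃ stk → StackWF e₃ stk → stk.getLast? = some ⟨G₁, r, 0⟩ →
      ∀ e ∈ stk, e.frame ∈ chainFrames e₃ G₁ r := fun stk hS hWF hl => frame_mem_chainFrames_of_stack hS hWF hl
  have hlat' : Real.sqrt ((L₁ (bp (mi i) (ai i) (bi i)) + s₀) 0 ^ 2 + (L₁ (bp (mi i) (ai i) (bi i)) + s₀) 1 ^ 2) +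
      8 / 3 * (h + 4 * R₀) ≤ ρ - 2 := by have := hlat i hi; linarith
  have hρ2 : 2 ≤ ρ := by
    have h1 := hlat i hi
    have h2 := Real.sqrt_nonneg ((L₁ (bp (mi i) (ai i) (bi i)) + s₀) 0 ^ 2 + (L₁ (bp (mi i) (ai i) (bi i)) + s₀) 1 ^ 2)
    have h3 : 0 ≤ 8 / 3 * (h + 4 * R₀) := by positivity
    linarith
  -- the end: not high (core avoidance), lateral radius, `≤ 11` contacts
  obtain ⟨hyX, hydeg, hylat, -⟩ := walkEnd_not_high_apart hX hsE hcert hσ₂ L₂ s₂ R₀ h ρ hρ2 P₂ hP₂X hcell hP₂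
    (chainFrames e₃ G₁ r) hM₁ hapart (s := (L₁ (bp (mi i) (ai i) (bi i)) + s₀, [⟨G₁, r, 0⟩])) hI hW hlast hlat' hfuel
  have hylat1 : (walkRun X e₃ N (L₁ (bp (mi i) (ai i) (bi i)) + s₀, [⟨G₁, r, 0⟩])).1 0 ^ 2 +
      (walkRun X e₃ N (L₁ (bp (mi i) (ai i) (bi i)) + s₀, [⟨G₁, r, 0⟩])).1 1 ^ 2 ≤ (ρ - 1) ^ 2 := hylat.trans (by nlinarith)
  -- NOT LOW by sealing: below `−R₀ − 2` the end would be a plate site with twelve neighbours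
  have hmono := walkRun_height_ge hX hsE hcert he₃n N (L₁ (bp (mi i) (ai i) (bi i)) + s₀, [⟨G₁, r, 0⟩]) hI
  simp only at hmono
  rw [he₃i, he₃i] at hmono
  set y := (walkRun X e₃ N (L₁ (bp (mi i) (ai i) (bi i)) + s₀, [⟨G₁, r, 0⟩])).1 with hy
  have hlow' : -R₀ - 2 ≤ y 2 := by
    by_contra hlt
    push Not at hlt
    have hyP : y ∈ P₁ := by
      by_contra hyP
      exact stacking_sealing_below hσ₁ L₁ s₀ (-(2 * R₀)) (-R₀) ρ hρ X P₁ hX hP₁X hP₁ y hyX hyP (hcell y hyX).1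
        (by linarith) hylat1
    obtain ⟨⟨y', hy'S, hyy'⟩, -, -, -⟩ := (hP₁ y).1 hyP
    obtain ⟨m, a, b, rfl⟩ := hy'S
    have hyy : L₁ (barlowPos 1 (Real.sqrt (2 / 3)) σ₁ m a b) + s₀ = y := hyy'
    have hcomp := barlowWindow_complete L₁ s₀ R₀ ρ hρ P₁ hP₁X hP₁ m a b (by rw [hyy]; linarith) (by rw [hyy]; linarith)
      (by rw [hyy]; exact hylat1)
    have h12 := twelve_le_card_contacts_of_complete_site hσ₁ L₁ s₀ m a b hcomp
    rw [hyy] at h12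
    omega
  have hPAY : y ∈ X.filter (fun y => (X.filter fun q => dist y q = 1).card ≠ 12 ∧ -R₀ - 2 ≤ y 2 ∧ y 2 ≤ h + R₀ + 2) :=
    walkEnd_mem_PAY_apart hX hsE hcert hσ₂ L₂ s₂ R₀ h ρ hρ2 P₂ hP₂X hcell hP₂ (chainFrames e₃ G₁ r)
      hM₁ hapart hI hW hlast hlat' hfuel hlow'
  exact ⟨hI, hW, hlast, ⟨⟨G₁, r, 0⟩, [], rfl, hC⟩, hfuel, hPAY⟩

end Cell

end Summit.Ventures.Crystal3D.Theorems

end
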